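import Summits.ResolutionOfSingularities.ResolutionOfSingularities.Theorems.FrobeniusLadderFInjectiveMacaulayficationRoadBFrame
import Summits.ResolutionOfSingularities.ResolutionOfSingularities.Theorems.FrobeniusLadderFInjectiveMacaulayficationKLocCellMod
import Summits.ResolutionOfSingularities.ResolutionOfSingularities.Theorems.FrobeniusLadderFInjectiveMacaulayficationKLocCellKitMod
import HarnessLib

/-!
# The road-B frame over TRUNCATED cells (crux `FInjectiveMacaulayfication`, road B at `p ≥ 11` / U11 glue)

[OURS · L1 W4.5a] Support file for crux stmt-ResolutionOfSingularities-15315 (res-L1-w45a-plan-1 R13.36 (2): «the frame glue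
`originPointFixable_of_cellsMod` / `KLocCellMod.honQuot_of_kLocCells_mod_range` is the one missing piece» for the T₁₁/11 · /13 cells
campaigns; author res-D-pv-018 AS res-L1-w45a-stub-6, author of the kit files `KLocCellKit`/`Sound`/`Norm`/`KitMod`).  This is
res-L1-w45a-stub-1's `RoadBFrame.hon_of_cells` / `originPointFixable_of_cells` / `cells_of_eq` / `cells_of_perm` / `cells_transport`
(p520874, p521519, p523636) with the cells binder WEAKENED to res-L1-w45a-stub-3's truncated form `hcellsMod` of `KLocCellMod`
(p524278: split identity only modulo `(Y_i^p : i ∈ S)`), fed by `KLocCellMod.honQuot_of_kLocCells_mod_range` instead of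
`KLocCellRange.honQuot_of_kLocCells_range`; every other binder and the conclusion are token-identical, so an instance file for a
truncated-cells campaign (`chart<c>_cellsMod` theorems via `KLocCellKit.klocCellsMod_of_check'`, p542226) is the `p = 7` instance file
with `originPointFixable_of_cells` ↦ `originPointFixable_of_cellsMod` and `cells_transport` ↦ `cellsMod_transport`.  Exact cells still
work through `KLocCellMod.cellsMod_of_cells`.  Pure glue; no definition; AI-written, weaker than expert review; no statement of
[claim: Hironaka2017] is used. [folklore]
-/

-- single-problem summit: the doubled namespace component is forced
set_option linter.dupNamespace false

noncomputable section

namespace Summit.ResolutionOfSingularities.ResolutionOfSingularities.Theorems.FInjectiveMacaulayfication.RoadBFrameMod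

open MvPolynomial AlgebraicGeometry
open Summit.ResolutionOfSingularities.ResolutionOfSingularities.Theorems.FInjectiveMacaulayfication

/-- **`hon` from TRUNCATED cells**: the per-chart `hon' c` binder of `PointFixableOfCert.pointFixable_of_ciCert` (r = 1) from the strata
cover `hSS` and the truncated cell packages `hcellsMod` (`KLocCellMod.honQuot_of_kLocCells_mod_range`). [folklore] -/
theorem hon_of_cellsMod (p : ℕ) [Fact p.Prime] (k : Type) [Field k] [CharP k p] (n t : ℕ)
    (V : Fin t → Matrix (Fin n) (Fin n) ℕ) (G : Fin t → List (ℤ × (Fin n → ℕ)))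
    (hg0 : ∀ c : Fin t, KLocCellKit.evalL k (G c) ≠ 0)
    (hX : ∀ (c : Fin t) (i : Fin n), ¬ (X i : MvPolynomial (Fin n) k) ∣ KLocCellKit.evalL k (G c))
    (SS : Fin t → List (Finset (Fin n)))
    (hSS : ∀ (c : Fin t) (T : Finset (Fin n)), (∀ j ∈ (Finset.univ : Finset (Fin n)), ∃ i ∈ T, 0 < V c i j) →
      ∃ S ∈ SS c, S ⊆ T)
    (hcellsMod : ∀ (c : Fin t), ∀ S ∈ SS c, ∃ (L : List ((Fin n →₀ ℕ) × MvPolynomial (Fin n) k)) (rr : List (MvPolynomial (Fin n) k))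
        (tt : Fin n → MvPolynomial (Fin n) k) (t₀ : MvPolynomial (Fin n) k),
        (L.map Prod.fst).Nodup ∧ (∀ e ∈ L, ∀ i : Fin n, e.1 i < p) ∧
        KLocCellKit.evalL k (G c) ^ (p - 1) - (L.map fun e => MvPolynomial.monomial e.1 (1 : k) * MvPolynomial.expand p e.2).sum ∈
          Ideal.span ((fun i : Fin n => (MvPolynomial.X i : MvPolynomial (Fin n) k) ^ p) '' (S : Set (Fin n))) ∧
        (1 : MvPolynomial (Fin n) k) = (List.zipWith (fun r e => r * MvPolynomial.expand p e.2) rr L).sum +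
          ∑ i ∈ S, tt i * MvPolynomial.X i + t₀ * KLocCellKit.evalL k (G c)) :
    ∀ (c : Fin t) (Q' : Ideal (MvPolynomial (Fin n) k ⧸ Ideal.span (Set.range
        ((fun c : Fin t => (![KLocCellKit.evalL k (G c)] : Fin 1 → MvPolynomial (Fin n) k)) c)))) [Q'.IsMaximal],
      (∀ j ∈ (Finset.univ : Finset (Fin n)), Ideal.Quotient.mk (Ideal.span (Set.range
          ((fun c : Fin t => (![KLocCellKit.evalL k (G c)] : Fin 1 → MvPolynomial (Fin n) k)) c)))
        (aeval (fun j : Fin n => ∏ i : Fin n, (X i : MvPolynomial (Fin n) k) ^ V c i j) (X j : MvPolynomial (Fin n) k)) ∈ Q') →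
        (∀ i : Fin n, (X i : MvPolynomial (Fin n) k) ∈ Q'.comap (Ideal.Quotient.mk (Ideal.span (Set.range
            ((fun c : Fin t => (![KLocCellKit.evalL k (G c)] : Fin 1 → MvPolynomial (Fin n) k)) c)))) →
          IsSMulRegular (Localization.AtPrime (Q'.comap (Ideal.Quotient.mk (Ideal.span (Set.range
              ((fun c : Fin t => (![KLocCellKit.evalL k (G c)] : Fin 1 → MvPolynomial (Fin n) k)) c))))) ⧸
              (Ideal.span (Set.range ((fun c : Fin t => (![KLocCellKit.evalL k (G c)] : Fin 1 → MvPolynomial (Fin n) k)) c))).map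
                (algebraMap (MvPolynomial (Fin n) k)
                (Localization.AtPrime (Q'.comap (Ideal.Quotient.mk (Ideal.span (Set.range
                  ((fun c : Fin t => (![KLocCellKit.evalL k (G c)] : Fin 1 → MvPolynomial (Fin n) k)) c))))))))
            (algebraMap (MvPolynomial (Fin n) k)
              (Localization.AtPrime (Q'.comap (Ideal.Quotient.mk (Ideal.span (Set.range
                ((fun c : Fin t => (![KLocCellKit.evalL k (G c)] : Fin 1 → MvPolynomial (Fin n) k)) c)))))) (X i))) ∧
        ∀ dd : ℕ, ringKrullDim (Localization.AtPrime Q') = dd → ∀ s : Fin dd → Localization.AtPrime Q',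
          (Ideal.span (Set.range s)).radical.IsMaximal →
            RingTheory.Sequence.IsWeaklyRegular (Localization.AtPrime Q') (List.ofFn s) ∧
            ∀ y : Localization.AtPrime Q', (∃ e : ℕ, y ^ p ^ e ∈ Ideal.span
              ((fun z : Localization.AtPrime Q' => z ^ p ^ e) ''
                (Ideal.span (Set.range s) : Set (Localization.AtPrime Q')))) → y ∈ Ideal.span (Set.range s) := by
  intro c
  exact KLocCellMod.honQuot_of_kLocCells_mod_range p k n Finset.univ (V c) ![KLocCellKit.evalL k (G c)] (hg0 c) (hX c)
    (SS c) (hSS c) (hcellsMod c)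

/-- **THE ROAD-B FRAME OVER TRUNCATED CELLS**: `RoadBFrame.originPointFixable_of_hon` fed by `hon_of_cellsMod` — point-fixability (PFix_p)
at the origin of the hypersurface `V(f)` from the fan/cover binders, the chart polynomials `G c`, the strata lists `SS c` and the TRUNCATED
cell packages. [folklore] -/
theorem originPointFixable_of_cellsMod (p : ℕ) [Fact p.Prime] (k : Type) [Field k] [CharP k p] (n t : ℕ) (ht : 0 < t)
    (A : Finset (Fin n →₀ ℕ)) (hprim : ∀ j ∈ (Finset.univ : Finset (Fin n)), ∃ N : ℕ, Finsupp.single j N ∈ A)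
    (hAJ : ∀ a ∈ A, ∃ j ∈ (Finset.univ : Finset (Fin n)), 0 < a j)
    (m : Fin t → (Fin n →₀ ℕ))
    (hcov : ∀ a ∈ A, ∃ (c : Fin t) (K : ℕ), 1 ≤ K ∧ ∃ y ∈ (Ideal.span ((fun b : Fin n →₀ ℕ =>
        (MvPolynomial.monomial b (1 : k) : MvPolynomial (Fin n) k)) '' (A : Set (Fin n →₀ ℕ)))) ^ (K - 1),
      (MvPolynomial.monomial a (1 : k) : MvPolynomial (Fin n) k) ^ K = MvPolynomial.monomial (m c) 1 * y)
    (V : Fin t → Matrix (Fin n) (Fin n) ℕ) (hV : ∀ c, IsUnit ((V c).map (Nat.cast : ℕ → ℤ)).det)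
    (a : Fin t → Fin n → (Fin n →₀ ℕ)) (haA : ∀ c i, a c i ∈ A)
    (hgen : ∀ (c : Fin t) (i : Fin n), (Finsupp.equivFunOnFinite.symm ((V c).mulVec ⇑(a c i)) : Fin n →₀ ℕ) =
      Finsupp.equivFunOnFinite.symm ((V c).mulVec ⇑(m c)) + Finsupp.single i 1)
    (hge : ∀ (c : Fin t), ∀ e ∈ A, (Finsupp.equivFunOnFinite.symm ((V c).mulVec ⇑(m c)) : Fin n →₀ ℕ) ≤
      Finsupp.equivFunOnFinite.symm ((V c).mulVec ⇑e))
    (f : MvPolynomial (Fin n) k) (hf0 : constantCoeff f = 0)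
    (hprime : (Ideal.span (Set.range (![f] : Fin 1 → MvPolynomial (Fin n) k))).IsPrime)
    (hXne : ∀ v : Fin n, Ideal.Quotient.mk (Ideal.span (Set.range (![f] : Fin 1 → MvPolynomial (Fin n) k))) (MvPolynomial.X v) ≠ 0)
    (G : Fin t → List (ℤ × (Fin n → ℕ))) (d : Fin t → Fin 1 → (Fin n →₀ ℕ))
    (hθF : ∀ c : Fin t, aeval (fun j : Fin n => ∏ i : Fin n, (X i : MvPolynomial (Fin n) k) ^ V c i j) f =
      monomial (d c 0) (1 : k) * KLocCellKit.evalL k (G c))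
    (hunit : ∀ (c : Fin t) (l : Fin 1), ∃ (N : ℕ) (r' : Fin n →₀ ℕ), N • m c = ∑ j : Fin n, d c l j • a c j + r')
    (hv : ∀ c : Fin t, Ideal.Quotient.mk (Ideal.span (Set.range (![f] : Fin 1 → MvPolynomial (Fin n) k))) (monomial (m c) (1 : k)) ∈
      (Ideal.span ((fun e : Fin n →₀ ℕ => Ideal.Quotient.mk (Ideal.span (Set.range (![f] : Fin 1 → MvPolynomial (Fin n) k)))
        (monomial e (1 : k))) '' (A : Set (Fin n →₀ ℕ)))))
    (hg0 : ∀ c : Fin t, KLocCellKit.evalL k (G c) ≠ 0)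
    (hX : ∀ (c : Fin t) (i : Fin n), ¬ (X i : MvPolynomial (Fin n) k) ∣ KLocCellKit.evalL k (G c))
    (SS : Fin t → List (Finset (Fin n)))
    (hSS : ∀ (c : Fin t) (T : Finset (Fin n)), (∀ j ∈ (Finset.univ : Finset (Fin n)), ∃ i ∈ T, 0 < V c i j) →
      ∃ S ∈ SS c, S ⊆ T)
    (hcellsMod : ∀ (c : Fin t), ∀ S ∈ SS c, ∃ (L : List ((Fin n →₀ ℕ) × MvPolynomial (Fin n) k)) (rr : List (MvPolynomial (Fin n) k))
        (tt : Fin n → MvPolynomial (Fin n) k) (t₀ : MvPolynomial (Fin n) k),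
        (L.map Prod.fst).Nodup ∧ (∀ e ∈ L, ∀ i : Fin n, e.1 i < p) ∧
        KLocCellKit.evalL k (G c) ^ (p - 1) - (L.map fun e => MvPolynomial.monomial e.1 (1 : k) * MvPolynomial.expand p e.2).sum ∈
          Ideal.span ((fun i : Fin n => (MvPolynomial.X i : MvPolynomial (Fin n) k) ^ p) '' (S : Set (Fin n))) ∧
        (1 : MvPolynomial (Fin n) k) = (List.zipWith (fun r e => r * MvPolynomial.expand p e.2) rr L).sum +
          ∑ i ∈ S, tt i * MvPolynomial.X i + t₀ * KLocCellKit.evalL k (G c)) :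
    ∀ b : Spec (.of (MvPolynomial (Fin n) k ⧸ Ideal.span (Set.range (![f] : Fin 1 → MvPolynomial (Fin n) k)))),
      b.asIdeal = Ideal.span (Set.range fun j : Fin n =>
        Ideal.Quotient.mk (Ideal.span (Set.range (![f] : Fin 1 → MvPolynomial (Fin n) k))) (X j)) →
      ∃ (nc : ℕ) (c : Fin nc → (Spec (.of (MvPolynomial (Fin n) k ⧸ Ideal.span (Set.range (![f] : Fin 1 → MvPolynomial (Fin n) k))))).presheaf.stalk b),
        Ideal.span (Set.range c) ≠ ⊥ ∧ (Ideal.span (Set.range c)).radical =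
          IsLocalRing.maximalIdeal ((Spec (.of (MvPolynomial (Fin n) k ⧸ Ideal.span (Set.range (![f] : Fin 1 → MvPolynomial (Fin n) k))))).presheaf.stalk b) ∧
        ∀ (j : Fin nc) (𝔔 : PrimeSpectrum (Literature.AlgebraicGeometry.Resolution.blowupAlgebra (Ideal.span (Set.range c)) (c j))),
          𝔔.asIdeal.comap (algebraMap ((Spec (.of (MvPolynomial (Fin n) k ⧸ Ideal.span (Set.range (![f] : Fin 1 → MvPolynomial (Fin n) k))))).presheaf.stalk b)
            (Literature.AlgebraicGeometry.Resolution.blowupAlgebra (Ideal.span (Set.range c)) (c j))) =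
            IsLocalRing.maximalIdeal ((Spec (.of (MvPolynomial (Fin n) k ⧸ Ideal.span (Set.range (![f] : Fin 1 → MvPolynomial (Fin n) k))))).presheaf.stalk b) →
          IsDomain (Localization.AtPrime 𝔔.asIdeal) ∧ ∀ dd : ℕ, ringKrullDim (Localization.AtPrime 𝔔.asIdeal) = dd →
            ∀ s : Fin dd → Localization.AtPrime 𝔔.asIdeal, (Ideal.span (Set.range s)).radical.IsMaximal →
              RingTheory.Sequence.IsWeaklyRegular (Localization.AtPrime 𝔔.asIdeal) (List.ofFn s) ∧
              ∀ y : Localization.AtPrime 𝔔.asIdeal, (∃ e : ℕ, y ^ p ^ e ∈ Ideal.span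
                ((fun z : Localization.AtPrime 𝔔.asIdeal => z ^ p ^ e) '' (Ideal.span (Set.range s) : Set (Localization.AtPrime 𝔔.asIdeal)))) →
                y ∈ Ideal.span (Set.range s) :=
  RoadBFrame.originPointFixable_of_hon p k n t ht A hprim hAJ m hcov V hV a haA hgen hge f hf0 hprime hXne G d hθF hunit hv
    (hon_of_cellsMod p k n t V G hg0 hX SS hSS hcellsMod)

/-- Transport of a truncated cell package along an equality of chart polynomials. [folklore] -/
theorem cellsMod_of_eq (p : ℕ) (k : Type) [Field k] {n : ℕ} (SS : List (Finset (Fin n))) {g₁ g₂ : MvPolynomial (Fin n) k}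
    (hg : g₁ = g₂)
    (h : ∀ S ∈ SS, ∃ (L : List ((Fin n →₀ ℕ) × MvPolynomial (Fin n) k)) (rr : List (MvPolynomial (Fin n) k))
        (tt : Fin n → MvPolynomial (Fin n) k) (t₀ : MvPolynomial (Fin n) k),
        (L.map Prod.fst).Nodup ∧ (∀ e ∈ L, ∀ i : Fin n, e.1 i < p) ∧
        g₁ ^ (p - 1) - (L.map fun e => MvPolynomial.monomial e.1 (1 : k) * MvPolynomial.expand p e.2).sum ∈
          Ideal.span ((fun i : Fin n => (MvPolynomial.X i : MvPolynomial (Fin n) k) ^ p) '' (S : Set (Fin n))) ∧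
        (1 : MvPolynomial (Fin n) k) = (List.zipWith (fun r e => r * MvPolynomial.expand p e.2) rr L).sum +
          ∑ i ∈ S, tt i * MvPolynomial.X i + t₀ * g₁) :
    ∀ S ∈ SS, ∃ (L : List ((Fin n →₀ ℕ) × MvPolynomial (Fin n) k)) (rr : List (MvPolynomial (Fin n) k))
        (tt : Fin n → MvPolynomial (Fin n) k) (t₀ : MvPolynomial (Fin n) k),
        (L.map Prod.fst).Nodup ∧ (∀ e ∈ L, ∀ i : Fin n, e.1 i < p) ∧
        g₂ ^ (p - 1) - (L.map fun e => MvPolynomial.monomial e.1 (1 : k) * MvPolynomial.expand p e.2).sum ∈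
          Ideal.span ((fun i : Fin n => (MvPolynomial.X i : MvPolynomial (Fin n) k) ^ p) '' (S : Set (Fin n))) ∧
        (1 : MvPolynomial (Fin n) k) = (List.zipWith (fun r e => r * MvPolynomial.expand p e.2) rr L).sum +
          ∑ i ∈ S, tt i * MvPolynomial.X i + t₀ * g₂ := by
  subst hg
  exact h

/-- A truncated cell package for a PERMUTED term list (`KLocCellKit.evalL` is permutation-invariant). [folklore] -/
theorem cellsMod_of_perm (p : ℕ) (k : Type) [Field k] {n : ℕ} (SS : List (Finset (Fin n))) {G₁ G₂ : List (ℤ × (Fin n → ℕ))}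
    (hG : G₁.Perm G₂)
    (h : ∀ S ∈ SS, ∃ (L : List ((Fin n →₀ ℕ) × MvPolynomial (Fin n) k)) (rr : List (MvPolynomial (Fin n) k))
        (tt : Fin n → MvPolynomial (Fin n) k) (t₀ : MvPolynomial (Fin n) k),
        (L.map Prod.fst).Nodup ∧ (∀ e ∈ L, ∀ i : Fin n, e.1 i < p) ∧
        KLocCellKit.evalL k G₁ ^ (p - 1) - (L.map fun e => MvPolynomial.monomial e.1 (1 : k) * MvPolynomial.expand p e.2).sum ∈
          Ideal.span ((fun i : Fin n => (MvPolynomial.X i : MvPolynomial (Fin n) k) ^ p) '' (S : Set (Fin n))) ∧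
        (1 : MvPolynomial (Fin n) k) = (List.zipWith (fun r e => r * MvPolynomial.expand p e.2) rr L).sum +
          ∑ i ∈ S, tt i * MvPolynomial.X i + t₀ * KLocCellKit.evalL k G₁) :
    ∀ S ∈ SS, ∃ (L : List ((Fin n →₀ ℕ) × MvPolynomial (Fin n) k)) (rr : List (MvPolynomial (Fin n) k))
        (tt : Fin n → MvPolynomial (Fin n) k) (t₀ : MvPolynomial (Fin n) k),
        (L.map Prod.fst).Nodup ∧ (∀ e ∈ L, ∀ i : Fin n, e.1 i < p) ∧
        KLocCellKit.evalL k G₂ ^ (p - 1) - (L.map fun e => MvPolynomial.monomial e.1 (1 : k) * MvPolynomial.expand p e.2).sum ∈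
          Ideal.span ((fun i : Fin n => (MvPolynomial.X i : MvPolynomial (Fin n) k) ^ p) '' (S : Set (Fin n))) ∧
        (1 : MvPolynomial (Fin n) k) = (List.zipWith (fun r e => r * MvPolynomial.expand p e.2) rr L).sum +
          ∑ i ∈ S, tt i * MvPolynomial.X i + t₀ * KLocCellKit.evalL k G₂ :=
  cellsMod_of_eq p k SS (RoadBFrame.evalL_eq_of_perm k hG) h

/-- Transport of a truncated cell package along a strata-list equality AND a term-list permutation (per-chart line of an instance
file: `cellsMod_transport k (by decide +kernel) (by decide +kernel) (…Cells<NN>.chart<c>_cellsMod k)`). [folklore] -/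
theorem cellsMod_transport (p : ℕ) (k : Type) [Field k] {n : ℕ} {SS₁ SS₂ : List (Finset (Fin n))} {G₁ G₂ : List (ℤ × (Fin n → ℕ))}
    (hS : SS₁ = SS₂) (hG : G₁.Perm G₂)
    (h : ∀ S ∈ SS₁, ∃ (L : List ((Fin n →₀ ℕ) × MvPolynomial (Fin n) k)) (rr : List (MvPolynomial (Fin n) k))
        (tt : Fin n → MvPolynomial (Fin n) k) (t₀ : MvPolynomial (Fin n) k),
        (L.map Prod.fst).Nodup ∧ (∀ e ∈ L, ∀ i : Fin n, e.1 i < p) ∧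
        KLocCellKit.evalL k G₁ ^ (p - 1) - (L.map fun e => MvPolynomial.monomial e.1 (1 : k) * MvPolynomial.expand p e.2).sum ∈
          Ideal.span ((fun i : Fin n => (MvPolynomial.X i : MvPolynomial (Fin n) k) ^ p) '' (S : Set (Fin n))) ∧
        (1 : MvPolynomial (Fin n) k) = (List.zipWith (fun r e => r * MvPolynomial.expand p e.2) rr L).sum +
          ∑ i ∈ S, tt i * MvPolynomial.X i + t₀ * KLocCellKit.evalL k G₁) :
    ∀ S ∈ SS₂, ∃ (L : List ((Fin n →₀ ℕ) × MvPolynomial (Fin n) k)) (rr : List (MvPolynomial (Fin n) k))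
        (tt : Fin n → MvPolynomial (Fin n) k) (t₀ : MvPolynomial (Fin n) k),
        (L.map Prod.fst).Nodup ∧ (∀ e ∈ L, ∀ i : Fin n, e.1 i < p) ∧
        KLocCellKit.evalL k G₂ ^ (p - 1) - (L.map fun e => MvPolynomial.monomial e.1 (1 : k) * MvPolynomial.expand p e.2).sum ∈
          Ideal.span ((fun i : Fin n => (MvPolynomial.X i : MvPolynomial (Fin n) k) ^ p) '' (S : Set (Fin n))) ∧
        (1 : MvPolynomial (Fin n) k) = (List.zipWith (fun r e => r * MvPolynomial.expand p e.2) rr L).sum +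
          ∑ i ∈ S, tt i * MvPolynomial.X i + t₀ * KLocCellKit.evalL k G₂ := by
  subst hS
  exact cellsMod_of_perm p k _ hG h

end Summit.ResolutionOfSingularities.ResolutionOfSingularities.Theorems.FInjectiveMacaulayfication.RoadBFrameMod

end
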